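import Summits.CriticalPhenomena.Ising3D.TaylorCertificateConeObligations
import Summits.CriticalPhenomena.Ising3D.TaylorOddQPoly
import Mathlib.Tactic.Linarith
import Mathlib.Tactic.Positivity
import Mathlib.Tactic.Ring
import HarnessLib

/-!
# Even head cells: introducing the `even_cell` field from a finite cell cover (twin of `TaylorConeOddCells`)
(cell `pub-ising3x`, drafted by seat recog-1 gen 10, landed by boot-1 gen 6 as part of the (g2) TABLE layer, which owns the even
tables; identical bookkeeping to the odd side: the `∀ Δ` quantifier of `even_cell` (a field shared VERBATIM by
`TaylorTermwiseObligations` and `TaylorConeObligations`) becomes finitely many cells with canonical head sets,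
the off-`F` terms being discharged by the even cone region `TaylorEvenRegion` via `evenForm_nonneg_of_det`)

HONEST FRAMING: lottery ticket; floor = tightest certified 3D Ising CFT bounds; no exact-solution
claim without a proof.
-/

namespace Summit.CriticalPhenomena.Ising3D

open Finset Set
open Literature.MathematicalPhysics.QuantumFieldTheory.ConformalBootstrap3D

/-- An even head-cell datum: (even) spin `ℓ`, closed `Δ`-interval `[a, b]`, head set `F`. [folklore] -/
structure EvenHeadCell where
  /-- the spin of the cell -/
  ℓ : ℕ
  /-- left end of the `Δ`-interval -/
  a : ℝ
  /-- right end of the `Δ`-interval -/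
  b : ℝ
  /-- the head set used on the cell -/
  F : Finset (ℕ × ℕ)

/-- **`even_cell` from a finite cell cover.** If every admissible even `(Δ, ℓ)` below `E₀` (A4 gap clause for
`ℓ = 0`: `Δ < 3 → Δ = Δε`) lies in a listed cell of its spin, each cell's head form is PSD uniformly on the cell (the
gap clause is handed to the cell, so the `ε`-row cell is checked AT `Δ = Δε`), every descendant term OFF `F` has
`a + n ≥ E₀`, and the even region holds from `E₀` on, then the `even_cell` field holds. [cite: KosPolandSimmonsduffin2014, §3.3 eq. (3.16)] -/
theorem evenCellField_of_cover (α : CrossingFunctional) (Q : Set (ℝ × ℝ)) (E₀ : ℝ) (cells : List EvenHeadCell)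
    (hcover : ∀ p ∈ Q, ∀ (ℓ : ℕ) (Δ : ℝ), Even ℓ → IsAdmissible3D Δ ℓ → Δ < E₀ →
      (ℓ = 0 → Δ < 3 → Δ = p.2) → ∃ c ∈ cells, c.ℓ = ℓ ∧ c.a ≤ Δ ∧ Δ ≤ c.b)
    (hhead : ∀ c ∈ cells, ∀ p ∈ Q, ∀ Δ : ℝ, c.a ≤ Δ → Δ ≤ c.b → IsAdmissible3D Δ c.ℓ → Δ < E₀ →
      (c.ℓ = 0 → Δ < 3 → Δ = p.2) →
      ∀ a b : ℝ, 0 ≤ ∑ q ∈ c.F, hrCoeff Δ c.ℓ q.1 q.2 / legendreLam c.ℓ *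
        α.evenForm p.1 p.2 (zMono (Δ + (q.1 : ℝ)) q.2) a b)
    (hF : ∀ c ∈ cells, ∀ q : ℕ × ℕ, q ∉ c.F → InDescendantRange c.ℓ q.1 q.2 → E₀ ≤ c.a + (q.1 : ℝ))
    (hregion : TaylorEvenRegion α Q E₀) :
    ∀ p ∈ Q, ∀ (ℓ : ℕ) (Δ : ℝ), Even ℓ → IsAdmissible3D Δ ℓ → Δ < E₀ →
      (ℓ = 0 → Δ < 3 → Δ = p.2) →
      ∃ F : Finset (ℕ × ℕ),
        (∀ a b : ℝ, 0 ≤ ∑ q ∈ F, hrCoeff Δ ℓ q.1 q.2 / legendreLam ℓ *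
          α.evenForm p.1 p.2 (zMono (Δ + (q.1 : ℝ)) q.2) a b) ∧
        (∀ q : ℕ × ℕ, q ∉ F → InDescendantRange ℓ q.1 q.2 →
          ∀ a b : ℝ, 0 ≤ α.evenForm p.1 p.2 (zMono (Δ + (q.1 : ℝ)) q.2) a b) := by
  intro p hp ℓ Δ hev hadm hE hgap
  obtain ⟨c, hc, hcℓ, ha, hb⟩ := hcover p hp ℓ Δ hev hadm hE hgap
  subst hcℓ
  refine ⟨c.F, hhead c hc p hp Δ ha hb hadm hE hgap, fun q hq hr a b => ?_⟩
  have hℓΔ : (c.ℓ : ℝ) ≤ Δ := (natCast_le_unitarityBound3D c.ℓ).trans hadm.1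
  have hE' : E₀ ≤ Δ + (q.1 : ℝ) := (hF c hc q hq hr).trans (by linarith)
  obtain ⟨hX, hY, hZ⟩ := hregion p hp (Δ + (q.1 : ℝ)) q.2 hE' (cast_le_add_of_inDescendantRange hℓΔ hr)
  exact α.evenForm_nonneg_of_det p.1 p.2 _ hX hY hZ a b

/-- **The even cover hypothesis spin by spin.** With `E₀ ≤ L + 1` only even spins `ℓ < L` need cells: `ℓ = 0`
needs cells containing every `Δε` of the box and cells covering `[3, E₀)`; even `2 ≤ ℓ < L` needs cells covering
`[ℓ+1, E₀)`. [folklore] -/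
theorem evenCover_of_perSpin (Q : Set (ℝ × ℝ)) (E₀ : ℝ) (cells : List EvenHeadCell) (L : ℕ)
    (hL : E₀ ≤ (L : ℝ) + 1)
    (hε : ∀ p ∈ Q, ∃ c ∈ cells, c.ℓ = 0 ∧ c.a ≤ p.2 ∧ p.2 ≤ c.b)
    (h0 : ∀ Δ : ℝ, 3 ≤ Δ → Δ < E₀ → ∃ c ∈ cells, c.ℓ = 0 ∧ c.a ≤ Δ ∧ Δ ≤ c.b)
    (hℓ : ∀ ℓ : ℕ, Even ℓ → 1 ≤ ℓ → ℓ < L → ∀ Δ : ℝ, (ℓ : ℝ) + 1 ≤ Δ → Δ < E₀ →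
      ∃ c ∈ cells, c.ℓ = ℓ ∧ c.a ≤ Δ ∧ Δ ≤ c.b) :
    ∀ p ∈ Q, ∀ (ℓ : ℕ) (Δ : ℝ), Even ℓ → IsAdmissible3D Δ ℓ → Δ < E₀ →
      (ℓ = 0 → Δ < 3 → Δ = p.2) → ∃ c ∈ cells, c.ℓ = ℓ ∧ c.a ≤ Δ ∧ Δ ≤ c.b := by
  intro p hp ℓ Δ hev hadm hE hgap
  rcases Nat.eq_zero_or_pos ℓ with hℓ0 | hℓpos
  · subst hℓ0
    rcases lt_or_ge Δ 3 with h3 | h3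
    · rw [hgap rfl h3]; exact hε p hp
    · exact h0 Δ h3 hE
  · have hbℓ : unitarityBound3D ℓ = (ℓ : ℝ) + 1 := by
      unfold unitarityBound3D; rw [if_neg (by omega)]
    have hb : (ℓ : ℝ) + 1 ≤ Δ := by rw [← hbℓ]; exact hadm.1
    by_cases hlt : ℓ < L
    · exact hℓ ℓ hev hℓpos hlt Δ hb hE
    · exfalso
      have : (L : ℝ) ≤ ℓ := by exact_mod_cast not_lt.mp hlt
      linarith

end Summit.CriticalPhenomena.Ising3D
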